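import Summits.BirchSwinnertonDyer.Rank1Residual.WAll.TargetAdditiveAtThreeWildLocalTypeDecompLine
import Literature.NumberTheory.EllipticCurves.MultiplicativeReductionDecompLineProofs
import Literature.NumberTheory.EllipticCurves.TamagawaPrimesEquivProofs
import HarnessLib
import HarnessLib.Audit.Tags

/-!
# Rung W-ALL, row 2 at `p = 3`, the wild rank-one TWIN cell read through Serre's local type, III:
# a class with NO `D_3`-stable line in `E[3]` (census bucket C) has no MULTIPLICATIVE twin either —
# its semistable twins are GOOD SUPERSINGULAR (theorems only; no new statement)

Cell `bsd-wall` (run/shared/lean/pub/bsd-wall/), lane (2), seat `bsd-wall-ty-1` (g10); completes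
`TargetAdditiveAtThreeWildLocalTypeDecompLine.lean` (g9: bucket C ⇒ no good ORDINARY twin, where the
MULTIPLICATIVE exclusion was left open because the tree stated the Tate line at `v ∣ p` on inertia
only).  BOOKKEEPING in the vocabulary of `O6.ModPCongruentAt` / `O6.ModPCongruent` /
`O6.HasSemistableModPTypeAt`: nothing asserted, no leaf typed, no named fact, no def.

MATHEMATICS.  At a place `v ∣ p` of MULTIPLICATIVE reduction, `p` odd, `E[p]` contains a line stable
under the decomposition group `D_v` (Tate: `E ≅ E_q` over an unramified quadratic extension,
`0 → μ_p → E[p] → ℤ/p → 0` as local Galois modules up to the unramified quadratic twist; Serre 1972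
§1.12, Silverman *Advanced Topics* V.5.3–5.4, V.6.1) — now the tree theorem
`WeierstrassCurve.exists_decompStableLine_geomTorsion_of_hasMultiplicativeReductionAt_rat_decomp`
(`Literature/NumberTheory/EllipticCurves/MultiplicativeReductionDecompLineProofs.lean`, proved from
the inertia line by uniqueness: the line receiving `τP - P` is unique once inertia moves `E[p]`, and
`D_v` normalises `I_v`).  A `D_v`-stable line is transported along a congruence at `v`
(`ModPCongruentAt.exists_decompStableLine_of_decompStableLine`, g9).  Hence:
* `ModPCongruentAt.exists_decompStableLine_of_mult` / `….not_mult_of_forall_not_decompStable` — a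
  curve congruent AT `v ∋ p` (`p` odd) to a MULTIPLICATIVE curve has a `D_v`-stable line in `E[p]`;
  contrapositively a class with no `D_v`-stable line («`ρ̄_{E,p}|D_v` irreducible», spelled inline,
  def-free) has no multiplicative congruent curve at `v`; `ModPCongruent.…` for global twins;
* with g9's ordinary exclusion: `ModPCongruent.goodSS_of_forall_not_decompStable_of_not_addv` — every
  twin SEMISTABLE at `p` of such a class is GOOD SUPERSINGULAR at `p` (`GoodSS`: good and `p ∣ a_p`),
  and `HasSemistableModPTypeAt.exists_goodSS_witness_of_forall_not_decompStable`;
* at `p = 3` on the twin-cell hypothesis of `WAllExclAddWildRankOneSurjTwin` VERBATIM: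
  `twin_not_mult_three_of_forall_not_decompStable`, `twin_goodSS_three_of_forall_not_decompStable`,
  `exists_goodSSTwin_three_of_twin_of_forall_not_decompStable`.

READING (census TWIN-PRINT-AT3-v1 §2; pss3 g5 2026-08-27T15:12:55Z decision (2): split UTD crux
`TwinSplitIMCAtThree` 20214 by twin type {GoodOrd, Mult (675), SS (603)}): with part II the three
local types of `ρ̄_{E,3}|D_3` now sort the twins CLASS-WIDE in the kernel — très ramifié (B) ⇒
multiplicative twins only (`…TresRamifie.lean`); no `D_3`-stable line (C) ⇒ good supersingular twins
only (this file + part II); so every good-ordinary or multiplicative twin belongs to a class with a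
`D_3`-stable line that is not très ramifié (A ∪ the peu-ramifié part), at every conductor.  Not
claimed: the converses (a good supersingular twin forces bucket C — needs the level-2 fundamental
character shape at supersingular `p`, Serre 1972 §1.11 Prop. 12, not in the tree in `D_v`-form).

References: `WAll/TargetAdditiveAtThreeWildLocalTypeDecompLine.lean`,
`WAll/TargetAdditiveAtThreeWildLocalTypeTresRamifie.lean`, `WAll/TargetAdditiveAtThreeWildTwinSlices.lean`;
HOME `TWIN-PRINT-AT3-v1.md` §2; [cite: SerreInventiones1972, §1.12 Prop. 13 and Cor.];
[cite: SilvermanATAEC1994, V §5 Thm. 5.3, Cor. 5.4, V §6 Prop. 6.1]; [cite: SerreInventiones1972, §1.11].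
-/

noncomputable section

open scoped Classical NumberField

open IsDedekindDomain Rat.HeightOneSpectrum
open WeierstrassCurve Literature.NumberTheory.EllipticCurves
  Literature.NumberTheory.EllipticCurves.Rank1Residual
  Literature.NumberTheory.GaloisRepresentations
open Summit.BirchSwinnertonDyer.Rank1Residual

set_option autoImplicit false

/-! ### §1. Vocabulary level, any odd prime `p` -/

namespace Summit.BirchSwinnertonDyer.Rank1Residual.O6

variable {W W' : WeierstrassCurve ℚ} {p : ℕ} {v : HeightOneSpectrum (𝓞 ℚ)}
variable [Fact p.Prime] [W'.IsElliptic]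

/-- **A curve congruent at `v ∋ p` (`p` odd) to a MULTIPLICATIVE curve has a `D_v`-stable line in
`E[p]`** (the Tate line `μ_p ⊗ (unr. quadratic)` of `E′[p]` — tree
`exists_decompStableLine_geomTorsion_of_hasMultiplicativeReductionAt_rat_decomp` —, transported along
the congruence). [cite: SerreInventiones1972, §1.12 Prop. 13 and Cor.]
[cite: SilvermanATAEC1994, V §5 Thm. 5.3, Cor. 5.4] -/
theorem ModPCongruentAt.exists_decompStableLine_of_mult (hc : ModPCongruentAt W' W p v)
    (hpv : ((p : ℕ) : 𝓞 ℚ) ∈ v.asIdeal) (hp2 : p ≠ 2) (hmult : Mult W' p) :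
    ∃ Λ : AddSubgroup (geomPoints W), Λ ≤ W.geomTorsion (p : ℤ) ∧ Nat.card Λ = p ∧
      ∀ σ ∈ GreenbergSelmer.decomp (K := ℚ) v, ∀ x ∈ Λ, σ • x ∈ Λ := by
  have hpe : (primesEquiv (R := 𝓞 ℚ) v : ℕ) = p :=
    (Literature.NumberTheory.Automorphic.BCDT.natCast_mem_asIdeal_iff_primesEquiv_eq v Fact.out).mp
      hpv
  have hmultv : W'.HasMultiplicativeReductionAt v :=
    (hasMultiplicativeReductionAtPrime_primesEquiv_iff_holds W' v p hpe).mp hmult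
  obtain ⟨Λ', hle, hcard, hstab, -⟩ :=
    W'.exists_decompStableLine_geomTorsion_of_hasMultiplicativeReductionAt_rat_decomp hp2 hpv hmultv
  exact hc.exists_decompStableLine_of_decompStableLine ⟨Λ', hle, hcard, hstab⟩

/-- **No multiplicative congruent curve for a locally irreducible `E[p]`.**  If no subgroup of order
`p` of `E[p]` is stable under `D_v` («`ρ̄_{E,p}|D_v` irreducible»; spelled inline), then no curve
congruent to `E` at `v ∋ p` (`p` odd) has multiplicative reduction at `p`.
[cite: SerreInventiones1972, §1.12 Prop. 13 and Cor.] -/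
theorem ModPCongruentAt.not_mult_of_forall_not_decompStable (hc : ModPCongruentAt W' W p v)
    (hpv : ((p : ℕ) : 𝓞 ℚ) ∈ v.asIdeal) (hp2 : p ≠ 2)
    (hirr : ∀ Λ : AddSubgroup (geomPoints W), Λ ≤ W.geomTorsion (p : ℤ) → Nat.card Λ = p →
      ∃ σ ∈ GreenbergSelmer.decomp (K := ℚ) v, ∃ x ∈ Λ, σ • x ∉ Λ) :
    ¬ Mult W' p := by
  intro hmult
  obtain ⟨Λ, hle, hcard, hstab⟩ := hc.exists_decompStableLine_of_mult hpv hp2 hmult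
  obtain ⟨σ, hσ, x, hx, hσx⟩ := hirr Λ hle hcard
  exact hσx (hstab σ hσ x hx)

/-- **Global twins of a locally irreducible class are not multiplicative at `p`** (`p` odd).
[cite: SerreInventiones1972, §1.12 Prop. 13 and Cor.] -/
theorem ModPCongruent.not_mult_of_forall_not_decompStable (hc : ModPCongruent W' W p) (hp2 : p ≠ 2)
    (hirr : ∀ (v : HeightOneSpectrum (𝓞 ℚ)), ((p : ℕ) : 𝓞 ℚ) ∈ v.asIdeal →
      ∀ Λ : AddSubgroup (geomPoints W), Λ ≤ W.geomTorsion (p : ℤ) → Nat.card Λ = p →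
        ∃ σ ∈ GreenbergSelmer.decomp (K := ℚ) v, ∃ x ∈ Λ, σ • x ∉ Λ) :
    ¬ Mult W' p := by
  obtain ⟨v, hpv⟩ : ∃ v : HeightOneSpectrum (𝓞 ℚ), ((p : ℕ) : 𝓞 ℚ) ∈ v.asIdeal :=
    ⟨(primesEquiv (R := 𝓞 ℚ)).symm ⟨p, Fact.out⟩,
      (Literature.NumberTheory.Automorphic.BCDT.natCast_mem_asIdeal_iff_primesEquiv_eq _ Fact.out).mpr
        (by rw [Equiv.apply_symm_apply])⟩
  exact (hc.modPCongruentAt v).not_mult_of_forall_not_decompStable hpv hp2 (hirr v hpv)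

/-- **Semistable twins of a locally irreducible class are GOOD SUPERSINGULAR at `p`** (`p` odd):
with part II (`mult_or_goodSS_of_forall_not_decompStable_of_not_addv`: multiplicative or good
supersingular) and `not_mult_of_forall_not_decompStable`.
[cite: SerreInventiones1972, §1.11 Prop. 11 and Cor., §1.12 Prop. 13 and Cor.] -/
theorem ModPCongruent.goodSS_of_forall_not_decompStable_of_not_addv [W'.IsGloballyMinimal]
    (hc : ModPCongruent W' W p) (hp2 : p ≠ 2)
    (hirr : ∀ (v : HeightOneSpectrum (𝓞 ℚ)), ((p : ℕ) : 𝓞 ℚ) ∈ v.asIdeal →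
      ∀ Λ : AddSubgroup (geomPoints W), Λ ≤ W.geomTorsion (p : ℤ) → Nat.card Λ = p →
        ∃ σ ∈ GreenbergSelmer.decomp (K := ℚ) v, ∃ x ∈ Λ, σ • x ∉ Λ)
    (hss : ¬ Addv W' p) : GoodSS W' p :=
  (hc.mult_or_goodSS_of_forall_not_decompStable_of_not_addv hirr hss).resolve_left
    (hc.not_mult_of_forall_not_decompStable hp2 hirr)

/-- **The twins of a locally irreducible class sort as: additive at `p`, or good supersingular at `p`**
(`p` odd) — the exhaustive form of the previous theorem.
[cite: SerreInventiones1972, §1.11 Prop. 11 and Cor., §1.12 Prop. 13 and Cor.] -/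
theorem ModPCongruent.addv_or_goodSS_of_forall_not_decompStable [W'.IsGloballyMinimal]
    (hc : ModPCongruent W' W p) (hp2 : p ≠ 2)
    (hirr : ∀ (v : HeightOneSpectrum (𝓞 ℚ)), ((p : ℕ) : 𝓞 ℚ) ∈ v.asIdeal →
      ∀ Λ : AddSubgroup (geomPoints W), Λ ≤ W.geomTorsion (p : ℤ) → Nat.card Λ = p →
        ∃ σ ∈ GreenbergSelmer.decomp (K := ℚ) v, ∃ x ∈ Λ, σ • x ∉ Λ) :
    Addv W' p ∨ GoodSS W' p := by
  by_cases hss : Addv W' p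
  · exact Or.inl hss
  · exact Or.inr (hc.goodSS_of_forall_not_decompStable_of_not_addv hp2 hirr hss)

variable (W) in
/-- **For a locally irreducible class the «semistable mod-`p` type» of
`TargetAdditiveAtThreeWildLocalTypeSlices.lean` §0 is a GOOD SUPERSINGULAR type**: every witness is
good supersingular at `p`, so a good supersingular witness exists at each `v ∋ p` (`p` odd).
[cite: SerreInventiones1972, §1.11–1.12] -/
theorem HasSemistableModPTypeAt.exists_goodSS_witness_of_forall_not_decompStable
    (h : HasSemistableModPTypeAt W p) (hp2 : p ≠ 2)
    (hirr : ∀ (v : HeightOneSpectrum (𝓞 ℚ)), ((p : ℕ) : 𝓞 ℚ) ∈ v.asIdeal →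
      ∀ Λ : AddSubgroup (geomPoints W), Λ ≤ W.geomTorsion (p : ℤ) → Nat.card Λ = p →
        ∃ σ ∈ GreenbergSelmer.decomp (K := ℚ) v, ∃ x ∈ Λ, σ • x ∉ Λ)
    (v : HeightOneSpectrum (𝓞 ℚ)) (hpv : ((p : ℕ) : 𝓞 ℚ) ∈ v.asIdeal) :
    ∃ (W'' : WeierstrassCurve ℚ) (_ : W''.IsElliptic) (_ : W''.IsGloballyMinimal),
      GoodSS W'' p ∧ ModPCongruentAt W'' W p v := by
  obtain ⟨W'', h1, h2, hss, hc⟩ := h v hpv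
  have hno : ¬ GoodOrd W'' p := hc.not_goodOrd_of_forall_not_decompStable hpv (hirr v hpv)
  have hnm : ¬ Mult W'' p := hc.not_mult_of_forall_not_decompStable hpv hp2 (hirr v hpv)
  have hg : Good W'' p := by
    by_contra hg
    exact hss ⟨hg, hnm⟩
  refine ⟨W'', h1, h2, ⟨hg, ?_⟩, hc⟩
  by_contra hdvd
  exact hno ⟨hg, hdvd⟩

end Summit.BirchSwinnertonDyer.Rank1Residual.O6

/-! ### §2. Leaf level at `p = 3`: the twin cell's twins of a locally irreducible class -/

namespace Summit.BirchSwinnertonDyer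

/-- **On the twin-cell hypothesis of `WAllExclAddWildRankOneSurjTwin` (VERBATIM): a twin `W′` of a
class with NO `D_3`-stable line in `E[3]` is NOT multiplicative at `3`** — census bucket C («irreducible
at 3»): route `UniversalToricDescent`'s crux #3 / the `Mult` child of its 2026-08-27 split is never
consumed there. [cite: SerreInventiones1972, §1.12 Prop. 13 and Cor.] -/
theorem twin_not_mult_three_of_forall_not_decompStable {W : WeierstrassCurve ℚ}
    (hirr : ∀ (v : HeightOneSpectrum (𝓞 ℚ)), ((3 : ℕ) : 𝓞 ℚ) ∈ v.asIdeal →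
      ∀ Λ : AddSubgroup (geomPoints W), Λ ≤ W.geomTorsion ((3 : ℕ) : ℤ) → Nat.card Λ = 3 →
        ∃ σ ∈ GreenbergSelmer.decomp (K := ℚ) v, ∃ x ∈ Λ, σ • x ∉ Λ)
    (W' : WeierstrassCurve ℚ) [W'.IsElliptic] (hc : O6.ModPCongruent W' W 3) : ¬ Mult W' 3 :=
  hc.not_mult_of_forall_not_decompStable (by decide) hirr

/-- **… hence a twin semistable at `3` is GOOD SUPERSINGULAR at `3`** (with part II).
[cite: SerreInventiones1972, §1.11 Prop. 11 and Cor., §1.12 Prop. 13 and Cor.] -/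
theorem twin_goodSS_three_of_forall_not_decompStable {W : WeierstrassCurve ℚ}
    (hirr : ∀ (v : HeightOneSpectrum (𝓞 ℚ)), ((3 : ℕ) : 𝓞 ℚ) ∈ v.asIdeal →
      ∀ Λ : AddSubgroup (geomPoints W), Λ ≤ W.geomTorsion ((3 : ℕ) : ℤ) → Nat.card Λ = 3 →
        ∃ σ ∈ GreenbergSelmer.decomp (K := ℚ) v, ∃ x ∈ Λ, σ • x ∉ Λ)
    (W' : WeierstrassCurve ℚ) [W'.IsElliptic] [W'.IsGloballyMinimal]
    (hc : O6.ModPCongruent W' W 3) (hss : ¬ Addv W' 3) : GoodSS W' 3 :=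
  hc.goodSS_of_forall_not_decompStable_of_not_addv (by decide) hirr hss

/-- **A locally irreducible class with a twin has a GOOD SUPERSINGULAR onto twin** (the twin-cell
existential of `WAllExclAddWildRankOneSurjTwin`, sharpened: the same witness, now known to be good
supersingular at `3`). [cite: SerreInventiones1972, §1.11–1.12] -/
theorem exists_goodSSTwin_three_of_twin_of_forall_not_decompStable {W : WeierstrassCurve ℚ}
    (hirr : ∀ (v : HeightOneSpectrum (𝓞 ℚ)), ((3 : ℕ) : 𝓞 ℚ) ∈ v.asIdeal →
      ∀ Λ : AddSubgroup (geomPoints W), Λ ≤ W.geomTorsion ((3 : ℕ) : ℤ) → Nat.card Λ = 3 →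
        ∃ σ ∈ GreenbergSelmer.decomp (K := ℚ) v, ∃ x ∈ Λ, σ • x ∉ Λ)
    (htwin : ∃ (W' : WeierstrassCurve ℚ) (_ : W'.IsElliptic) (_ : W'.IsGloballyMinimal),
      O6.ModPCongruent W' W 3 ∧ ¬ Addv W' 3 ∧ W'.HasSurjectiveModNGaloisRep 3) :
    ∃ (W' : WeierstrassCurve ℚ) (_ : W'.IsElliptic) (_ : W'.IsGloballyMinimal),
      O6.ModPCongruent W' W 3 ∧ GoodSS W' 3 ∧ W'.HasSurjectiveModNGaloisRep 3 := by
  obtain ⟨W', h1, h2, hc, hss, hsurj⟩ := htwin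
  exact ⟨W', h1, h2, hc, twin_goodSS_three_of_forall_not_decompStable hirr W' hc hss, hsurj⟩

/-- **Exhaustive sorting of the twins of a locally irreducible class at `3`: additive or good
supersingular** — neither good ordinary (part II) nor multiplicative (this file).
[cite: SerreInventiones1972, §1.11–1.12] -/
theorem twin_addv_or_goodSS_three_of_forall_not_decompStable {W : WeierstrassCurve ℚ}
    (hirr : ∀ (v : HeightOneSpectrum (𝓞 ℚ)), ((3 : ℕ) : 𝓞 ℚ) ∈ v.asIdeal →
      ∀ Λ : AddSubgroup (geomPoints W), Λ ≤ W.geomTorsion ((3 : ℕ) : ℤ) → Nat.card Λ = 3 →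
        ∃ σ ∈ GreenbergSelmer.decomp (K := ℚ) v, ∃ x ∈ Λ, σ • x ∉ Λ)
    (W' : WeierstrassCurve ℚ) [W'.IsElliptic] [W'.IsGloballyMinimal]
    (hc : O6.ModPCongruent W' W 3) : Addv W' 3 ∨ GoodSS W' 3 :=
  hc.addv_or_goodSS_of_forall_not_decompStable (by decide) hirr

end Summit.BirchSwinnertonDyer
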